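import Summits.HubbardSuperconductivity.HubbardSuperconductivity.Theorems.AnisotropyChordTransferFibre3RowCPsi
import Summits.HubbardSuperconductivity.HubbardSuperconductivity.Theorems.AnisotropyChordTransferFibre3TtailBounds
import Summits.HubbardSuperconductivity.HubbardSuperconductivity.Theorems.AnisotropyChordTransferFibre3OneLoop
import Summits.HubbardSuperconductivity.HubbardSuperconductivity.Theorems.AnisotropyChordTransferFibre3Delta3Bound
import Summits.HubbardSuperconductivity.HubbardSuperconductivity.Theorems.AnisotropyChordTransferFibre3OneLoopKit
import Summits.HubbardSuperconductivity.HubbardSuperconductivity.Theorems.AnisotropyChordTransferFibre3RowDTriple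
import Summits.HubbardSuperconductivity.HubbardSuperconductivity.Theorems.AnisotropyChordTransferFibre3Lam2Small

/-!
# Route `AnisotropyChord` / H0 rotor rung, row C (KT-2b) of the LEVEL-2 certificate: the phase-defect moment `X` as a
POSITIVE, L-UNIFORM two-propagator Fourier sum (`XParseval`)

PartN41-C §2 (port `…Fibre3KT2bRow`) feeds `X = Σ_a R(a)(1 − cos θ(aₓ − 1))` to `Cs2RealSpaceBound` through
`XmomNamed` + `TauNamed` + `TxBracket`: `X = R̄ − Re(e^{iθ}τₓ(K₁)) + η²(1 + cos θ)`.  That form is EXACT but it is a difference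
of named sums of size `O(η² V)` (at `L = 128`, `Δ = 0.1`: `Σ s² = 91.29`, `|t(K₁)| = 55.5` against `X = 0.0734`; cancellation
×1500, ×6000 at `L = 256`), so it cannot be evaluated by L-uniform interval brackets (p1 g28 FINDING, STATUS 2026-08-30).
THIS FILE replaces it by completing the square in Fourier space:
* ★ `xmom_parseval`:  `V·(X + η_eff²·ε₁) = (c_s²/2)·Σ_p |(1 − e^{−iθpₓ})(g(p) − g(p − K₁)) + (1 − e^{−iθ})·g(p − K₁)|²`
  for the ground profile (`L ≥ 5`, `0 ≤ Δ`), every summand a `normSq` (so window truncations bound it from BELOW and the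
  tail is a positive convergent sum `O(K⁻²)`, uniformly in `L`);
* ★ `xmom_eq_XSn`:  `X = c_s²·XSn/(8π²) − η_eff²·ε₁` with the normalised named sum `XSn := θ²·Σ_p |…|²`
  (numerically `XSn = 4.02 … 4.23` for `ν = 0.002 … 0.031`, `L`-variation `128 → 512` below `0.2 %`).
Ingredients: the contact values `φ(0) = η_eff`, `φ(x̂) = −η_eff` of `φ := ∇ₓ s` (`xmom_add_contact`), Parseval
(`normSq_dft_sum`), the convolution theorem (`fsqFourier_holds`), `φ̂(p) = c_s(1 − e^{−ipₓ})g(p)` (`RowC.dft_Dgrad`,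
`dft_sfun'`), and `Σ|α|² − Re(w Σ α conj β) = ½Σ|α − w̄β|²` for the unimodular `w = e^{iθ}` after the reindexing `p ↦ p − K₁`.
Prover seat `hubbard-h0-rotor-p1` g28 (route lead); helper for piece A = stmt-HubbardSuperconductivity-23918 of rung 19089
(`--supports`, helper class).  WHAT THIS IS NOT: nothing here proves superconductivity in the Hubbard model; it re-expresses one
input of ONE row of ONE conditional reduction (the GM₃ ∀L certificate); the rotor TARGET as originally worded stays FALSE
(g15 verdict).  Tree imports only; no sorry, no new axioms.
-/

set_option linter.dupNamespace false
set_option autoImplicit false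

noncomputable section

open scoped BigOperators
open Complex

namespace Summit.HubbardSuperconductivity.HubbardSuperconductivity.Theorems.AnisotropyChord.Transfer.Fibre3

namespace RowC

variable (L : ℕ) [NeZero L]

/-! ## The objects -/

/-- the x-gradient field of the pair function, `φ(a) := (∇ₓ s)(a) = s(a) − s(a − x̂)`. -/
def phiX (Δ : ℝ) (f : Tor L → ℝ) : Tor L → ℝ := fun a => gradx L (sfun L Δ f) a

/-- the summand of the positive Fourier form of `X`:
`u(p) := (1 − e^{−ipₓ})·(g(p) − g(p − K₁)) + (1 − e^{−iθ})·g(p − K₁)`. -/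
def xsTerm (lam2 : ℝ) (p : Tor L) : ℂ :=
  (1 - zPh L p (ex L)) * (((gres L lam2 p - gres L lam2 (p - K1 L) : ℝ)) : ℂ)
    + (1 - zPh L (K1 L) (ex L)) * ((gres L lam2 (p - K1 L) : ℝ) : ℂ)

/-- ★ the L-uniform named sum of row C: `XSn := θ²·Σ_p |u(p)|²` (`θ = 2π/L`). -/
def XSn (lam2 : ℝ) : ℝ := (2 * Real.pi / L) ^ 2 * ∑ p : Tor L, Complex.normSq (xsTerm L lam2 p)

/-! ## Step 1: the contact values of `φ` and `X + η²ε₁ = Σ_a φ(a)²(1 − cos θ(aₓ − 1))` -/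

omit [NeZero L] in
/-- `φ(0) = (1 − Δ) f(x̂)` for an even profile (`L ≥ 2`). [folklore] -/
theorem phiX_zero (hL : 2 ≤ L) {Δ : ℝ} {f : Tor L → ℝ} (heven : ∀ r : Tor L, f (-r) = f r) :
    phiX L Δ f 0 = (1 - Δ) * f (K1 L) := by
  unfold phiX gradx sfun
  have hK : (0 : Tor L) - K1 L = -(K1 L) := by abel
  have h0 : -(K1 L) ≠ (0 : Tor L) := by
    intro h; exact K1_ne_zero L hL (neg_eq_zero.mp h)
  rw [if_pos rfl, hK, if_neg h0, heven]
  ring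

omit [NeZero L] in
/-- `φ(x̂) = −(1 − Δ) f(x̂)` (`L ≥ 2`). [folklore] -/
theorem phiX_K1 (hL : 2 ≤ L) {Δ : ℝ} {f : Tor L → ℝ} :
    phiX L Δ f (K1 L) = -((1 - Δ) * f (K1 L)) := by
  unfold phiX gradx sfun
  rw [if_neg (K1_ne_zero L hL), sub_self, if_pos rfl]
  ring

omit [NeZero L] in
/-- the phase-defect weight through characters: `cos θ(aₓ − 1) = Re(φ_{K₁}(x̂)·conj φ_{K₁}(a))`. [folklore] -/
theorem cos_weight_eq_re [NeZero L] (hL : 2 ≤ L) (a : Tor L) :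
    Real.cos (2 * Real.pi * ((a.1.val : ℝ) - 1) / L)
      = (phase L (K1 L) (ex L) * (starRingEnd ℂ) (phase L (K1 L) a)).re := by
  rw [phase_comm L (K1 L) a, K1_eq_ex, phase_ex, phase_ex, ← Complex.exp_conj, ← Complex.exp_add]
  have hv : ((ex L).1.val : ℕ) = 1 := by
    unfold ex
    simp only [ZMod.val_one_eq_one_mod]
    exact Nat.one_mod_eq_one.2 (by omega)
  rw [hv]
  simp only [map_mul, map_div₀, Complex.conj_I, Complex.conj_ofReal, map_natCast, map_ofNat, Nat.cast_one]
  have : 2 * (Real.pi : ℂ) * I * (1 / (L : ℂ)) + 2 * (Real.pi : ℂ) * -I * (((a.1.val : ℕ) : ℂ) / (L : ℂ))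
      = ((-(2 * Real.pi * ((a.1.val : ℝ) - 1) / L) : ℝ) : ℂ) * I := by
    push_cast; ring
  rw [this, Complex.exp_ofReal_mul_I_re, Real.cos_neg]

/-- ★ `X + η_eff²·ε₁ = Σ_a φ(a)²·(1 − cos θ(aₓ − 1))` (the two contact sites carry `φ² = η²` with weights `ε₁` and `0`). [folklore] -/
theorem xmom_add_contact (hL : 3 ≤ L) {Δ lam2 : ℝ} {f : Tor L → ℝ} (hf : IsGroundTwoMagnon L Δ lam2 f) :
    Xmom L Δ f + etaEff L lam2 ^ 2 * eps1 L
      = ∑ a : Tor L, phiX L Δ f a ^ 2 * (1 - Real.cos (2 * Real.pi * ((a.1.val : ℝ) - 1) / L)) := by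
  classical
  have hL2 : 2 ≤ L := by omega
  have hη : etaEff L lam2 = (1 - Δ) * f (K1 L) := etaEff_eq L hL hf.1
  have heven : ∀ r : Tor L, f (-r) = f r := hf.2.1
  have hK0 : K1 L ≠ 0 := K1_ne_zero L hL2
  -- split off the two contact sites from the full sum
  have hsplit : ∑ a : Tor L, phiX L Δ f a ^ 2 * (1 - Real.cos (2 * Real.pi * ((a.1.val : ℝ) - 1) / L))
      = ∑ a : Tor L, Rwt L Δ f a * (1 - Real.cos (2 * Real.pi * ((a.1.val : ℝ) - 1) / L))
        + phiX L Δ f 0 ^ 2 * (1 - Real.cos (2 * Real.pi * (((0 : Tor L).1.val : ℝ) - 1) / L))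
        + phiX L Δ f (K1 L) ^ 2 * (1 - Real.cos (2 * Real.pi * (((K1 L).1.val : ℝ) - 1) / L)) := by
    have hpt : ∀ a : Tor L, phiX L Δ f a ^ 2 * (1 - Real.cos (2 * Real.pi * ((a.1.val : ℝ) - 1) / L))
        = Rwt L Δ f a * (1 - Real.cos (2 * Real.pi * ((a.1.val : ℝ) - 1) / L))
          + (if a = 0 then phiX L Δ f 0 ^ 2 * (1 - Real.cos (2 * Real.pi * (((0 : Tor L).1.val : ℝ) - 1) / L)) else 0)
          + (if a = K1 L then phiX L Δ f (K1 L) ^ 2 * (1 - Real.cos (2 * Real.pi * (((K1 L).1.val : ℝ) - 1) / L)) else 0) := by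
      intro a
      unfold Rwt phiX
      by_cases h0 : a = 0
      · subst h0
        rw [if_pos (Or.inl rfl), if_pos rfl, if_neg (Ne.symm hK0)]; ring
      · by_cases h1 : a = K1 L
        · subst h1
          rw [if_pos (Or.inr rfl), if_neg hK0, if_pos rfl]; ring
        · rw [if_neg (by tauto), if_neg h0, if_neg h1]; ring
    rw [Finset.sum_congr rfl fun a _ => hpt a, Finset.sum_add_distrib, Finset.sum_add_distrib,
      Finset.sum_ite_eq' Finset.univ (0 : Tor L), Finset.sum_ite_eq' Finset.univ (K1 L)]
    simp only [Finset.mem_univ, if_true]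
  rw [hsplit, phiX_zero L hL2 heven, phiX_K1 L hL2, hη]
  have hv0 : ((0 : Tor L).1.val : ℝ) = 0 := by simp
  have hv1 : ((K1 L).1.val : ℝ) = 1 := by
    unfold K1
    simp only [ZMod.val_one_eq_one_mod]
    rw [Nat.one_mod_eq_one.2 (by omega)]; simp
  rw [hv0, hv1]
  unfold Xmom eps1
  have hc : Real.cos (2 * Real.pi * ((0 : ℝ) - 1) / L) = Real.cos (2 * Real.pi / L) := by
    rw [← Real.cos_neg]; congr 1; ring
  rw [hc, show (2 * Real.pi * ((1 : ℝ) - 1) / L) = 0 by ring, Real.cos_zero]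
  ring

/-! ## Step 2: the weighted sum through `Σ φ²` and `FT[φ²](K₁)` -/

/-- `Σ_a φ(a)²(1 − cos θ(aₓ−1)) = Σ_a φ(a)² − Re(φ_{K₁}(x̂)·FT[φ²](K₁))`. [folklore] -/
theorem weighted_eq_dft (hL : 2 ≤ L) (φ : Tor L → ℝ) :
    ∑ a : Tor L, φ a ^ 2 * (1 - Real.cos (2 * Real.pi * ((a.1.val : ℝ) - 1) / L))
      = (∑ a : Tor L, φ a ^ 2) - (phase L (K1 L) (ex L) * dft L (fun a => φ a ^ 2) (K1 L)).re := by
  unfold dft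
  rw [Finset.mul_sum, Complex.re_sum, ← Finset.sum_sub_distrib]
  refine Finset.sum_congr rfl fun a _ => ?_
  rw [cos_weight_eq_re L hL a, ← mul_assoc]
  have : ((phase L (K1 L) (ex L) * (starRingEnd ℂ) (phase L (K1 L) a)) * ((φ a ^ 2 : ℝ) : ℂ)).re
      = (phase L (K1 L) (ex L) * (starRingEnd ℂ) (phase L (K1 L) a)).re * φ a ^ 2 := by
    rw [Complex.re_mul_ofReal]
  push_cast at this ⊢
  rw [this]; ring

/-! ## Step 3: completing the square after Parseval -/

/-- `Σ_p |α(p)|² − Re(w·Σ_p α(p)·conj α(p − K₁)) = ½·Σ_p |α(p) − conj w · α(p − K₁)|²` for a unimodular `w`. [folklore] -/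
theorem complete_square (α : Tor L → ℂ) (w : ℂ) (hw : Complex.normSq w = 1) :
    (∑ p : Tor L, Complex.normSq (α p)) - (w * ∑ p : Tor L, α p * (starRingEnd ℂ) (α (p - K1 L))).re
      = (1 / 2 : ℝ) * ∑ p : Tor L, Complex.normSq (α p - (starRingEnd ℂ) w * α (p - K1 L)) := by
  have hshift : ∑ p : Tor L, Complex.normSq (α (p - K1 L)) = ∑ p : Tor L, Complex.normSq (α p) :=
    Fintype.sum_equiv (Equiv.subRight (K1 L)) _ _ fun p => rfl
  have hpt : ∀ p : Tor L, Complex.normSq (α p - (starRingEnd ℂ) w * α (p - K1 L))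
      = Complex.normSq (α p) + Complex.normSq (α (p - K1 L))
        - 2 * (w * (α p * (starRingEnd ℂ) (α (p - K1 L)))).re := by
    intro p
    rw [Complex.normSq_sub, Complex.normSq_mul, Complex.normSq_conj, hw, one_mul, map_mul, Complex.conj_conj]
    congr 1
    congr 1
    congr 1
    ring
  rw [Finset.sum_congr rfl fun p _ => hpt p, Finset.sum_sub_distrib, Finset.sum_add_distrib, hshift,
    Finset.mul_sum, Complex.re_sum, ← Finset.mul_sum]
  ring

/-! ## Step 4: `φ̂(p) = c_s·(1 − e^{−ipₓ})·g(p)` -/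

/-- the Fourier transform of `φ = ∇ₓ s` for the ground profile (`L ≥ 5`, `0 ≤ Δ`). [folklore] -/
theorem dft_phiX (hL : 5 ≤ L) {Δ lam2 : ℝ} (hΔ0 : 0 ≤ Δ) {f : Tor L → ℝ} (hf : IsGroundTwoMagnon L Δ lam2 f)
    (p : Tor L) :
    dft L (phiX L Δ f) p = ((cS L Δ lam2 f : ℝ) : ℂ) * ((1 - zPh L p (ex L)) * ((gres L lam2 p : ℝ) : ℂ)) := by
  have hl2 := lam2_lt_two_eps1 L hL hΔ0 hf
  have hD : phiX L Δ f = fun a => Dgrad L (sfun' L Δ f) (ex L) a := by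
    funext a; unfold phiX gradx Dgrad; rw [K1_eq_ex]; rfl
  rw [hD, dft_Dgrad L (sfun' L Δ f) (ex L) p, dft_sfun' L (by omega) hf.1 hl2 p]
  unfold gres
  by_cases hp : p = 0
  · subst hp
    rw [if_pos rfl, if_pos rfl]
    unfold zPh
    rw [phase_zero_left]
    simp
  · rw [if_neg hp, if_neg hp]
    push_cast
    ring

/-! ## Step 5: the assembly -/

/-- `conj φ_{p − K₁}(x̂) = conj φ_p(x̂) · φ_{K₁}(x̂)`, i.e. `z(p − K₁) = z(p)·w`. [folklore] -/
theorem zPh_sub_K1 (p : Tor L) : zPh L (p - K1 L) (ex L) = zPh L p (ex L) * phase L (K1 L) (ex L) := by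
  unfold zPh
  exact RowD.conj_phase_sub_K1 L p (ex L)

/-- ★★ **`XParseval`**: `V·(X + η_eff²·ε₁) = (c_s²/2)·Σ_p |u(p)|²` for the ground profile (`L ≥ 5`, `0 ≤ Δ`). [folklore] -/
theorem xmom_parseval (hL : 5 ≤ L) {Δ lam2 : ℝ} (hΔ0 : 0 ≤ Δ) {f : Tor L → ℝ} (hf : IsGroundTwoMagnon L Δ lam2 f) :
    (L : ℝ) ^ 2 * (Xmom L Δ f + etaEff L lam2 ^ 2 * eps1 L)
      = cS L Δ lam2 f ^ 2 / 2 * ∑ p : Tor L, Complex.normSq (xsTerm L lam2 p) := by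
  classical
  have hL2 : 2 ≤ L := by omega
  set φ := phiX L Δ f with hφ
  set w : ℂ := phase L (K1 L) (ex L) with hw
  have hwn : Complex.normSq w = 1 := normSq_phase L (K1 L) (ex L)
  -- Steps 1 and 2
  rw [xmom_add_contact L (by omega) hf, weighted_eq_dft L hL2 φ]
  -- Parseval and the convolution theorem
  have hP : (L : ℝ) ^ 2 * ∑ a : Tor L, φ a ^ 2 = ∑ p : Tor L, Complex.normSq (dft L φ p) :=
    (normSq_dft_sum L φ).symm
  have hLC : (L : ℂ) ≠ 0 := by exact_mod_cast (NeZero.ne L)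
  have hVC : ((L : ℂ) ^ 2) ≠ 0 := pow_ne_zero 2 hLC
  have hC : ((L : ℝ) ^ 2 : ℝ) * (w * dft L (fun a => φ a ^ 2) (K1 L)).re
      = (w * ∑ p : Tor L, dft L φ p * (starRingEnd ℂ) (dft L φ (p - K1 L))).re := by
    rw [fsqFourier_holds L φ (K1 L)]
    have hre : ∀ p : Tor L, dft L φ (K1 L - p) = (starRingEnd ℂ) (dft L φ (p - K1 L)) := by
      intro p; rw [← dft_neg L φ (p - K1 L), neg_sub]
    simp only [hre]
    have : ((L : ℝ) ^ 2 : ℝ) * (w * ((∑ p : Tor L, dft L φ p * (starRingEnd ℂ) (dft L φ (p - K1 L))) / (L : ℂ) ^ 2)).re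
        = ((((L : ℝ) ^ 2 : ℝ) : ℂ) * (w * ((∑ p : Tor L, dft L φ p * (starRingEnd ℂ) (dft L φ (p - K1 L))) / (L : ℂ) ^ 2))).re := by
      rw [Complex.re_ofReal_mul]
    rw [this]
    congr 1
    push_cast
    field_simp
  -- combine
  have hmain : (L : ℝ) ^ 2 * ((∑ a : Tor L, φ a ^ 2) - (w * dft L (fun a => φ a ^ 2) (K1 L)).re)
      = (1 / 2 : ℝ) * ∑ p : Tor L, Complex.normSq (dft L φ p - (starRingEnd ℂ) w * dft L φ (p - K1 L)) := by
    rw [mul_sub, hP, hC, complete_square L (dft L φ) w hwn]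
  rw [hmain]
  -- identify the summand
  have hterm : ∀ p : Tor L, dft L φ p - (starRingEnd ℂ) w * dft L φ (p - K1 L)
      = ((cS L Δ lam2 f : ℝ) : ℂ) * xsTerm L lam2 p := by
    intro p
    rw [hφ, dft_phiX L hL hΔ0 hf p, dft_phiX L hL hΔ0 hf (p - K1 L), zPh_sub_K1 L p]
    unfold xsTerm zPh
    rw [hw]
    have hu : (starRingEnd ℂ) (phase L (K1 L) (ex L)) * phase L (K1 L) (ex L) = 1 := by
      rw [mul_comm, Complex.mul_conj]; exact_mod_cast hwn
    push_cast
    linear_combination ((gres L lam2 (p - K1 L) : ℂ)) * ((cS L Δ lam2 f : ℂ)) * (starRingEnd ℂ) (phase L p (ex L)) * hu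
  simp only [hterm, Complex.normSq_mul, Complex.normSq_ofReal, ← Finset.mul_sum]
  ring

/-- ★ **`X` through the normalised named sum**: `X = c_s²·XSn/(8π²) − η_eff²·ε₁` (`L ≥ 5`, `0 ≤ Δ`). [folklore] -/
theorem xmom_eq_XSn (hL : 5 ≤ L) {Δ lam2 : ℝ} (hΔ0 : 0 ≤ Δ) {f : Tor L → ℝ} (hf : IsGroundTwoMagnon L Δ lam2 f) :
    Xmom L Δ f = cS L Δ lam2 f ^ 2 * XSn L lam2 / (8 * Real.pi ^ 2) - etaEff L lam2 ^ 2 * eps1 L := by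
  have h := xmom_parseval L hL hΔ0 hf
  have hL0 : (0 : ℝ) < L := by exact_mod_cast (show 0 < L by omega)
  have hπ := Real.pi_pos
  unfold XSn
  have hθ : (L : ℝ) ^ 2 * (2 * Real.pi / L) ^ 2 = 4 * Real.pi ^ 2 := by field_simp; ring
  have : cS L Δ lam2 f ^ 2 * ((2 * Real.pi / L) ^ 2 * ∑ p : Tor L, Complex.normSq (xsTerm L lam2 p)) / (8 * Real.pi ^ 2)
      = (cS L Δ lam2 f ^ 2 / 2 * ∑ p : Tor L, Complex.normSq (xsTerm L lam2 p)) / (L : ℝ) ^ 2 := by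
    field_simp
    ring
  rw [this, ← h]
  field_simp
  ring

/-- `XSn ≥ 0`. [folklore] -/
theorem XSn_nonneg (lam2 : ℝ) : 0 ≤ XSn L lam2 := by
  unfold XSn
  exact mul_nonneg (by positivity) (Finset.sum_nonneg fun p _ => Complex.normSq_nonneg _)

end RowC

end Summit.HubbardSuperconductivity.HubbardSuperconductivity.Theorems.AnisotropyChord.Transfer.Fibre3

end
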